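import Summits.HubbardSuperconductivity.HubbardSuperconductivity.Theorems.ThermalWedgeTwExponentialCeilingFunctor
import Summits.HubbardSuperconductivity.HubbardSuperconductivity.Theorems.ThermalWedgeTwExponentialCeilingSlater
import Literature.MathematicalPhysics.QuantumLattice.TorusBandFillingWindow
import Literature.MathematicalPhysics.QuantumLattice.DWaveSourceFreeGainBound

/-!
# Route `ThermalWedge`, item `TwExponentialCeiling` (stmt-HubbardSuperconductivity-1704):
# the UNCONDITIONAL Legendre ceiling on the every-ground-state `d`-wave order

Support file (`--supports stmt-HubbardSuperconductivity-1704`). The item asks for the exponential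
ceiling `C e^{-a/U}/U`, which needs the interacting pair susceptibility (crux stmt-1696, open) and
sharp ensemble equivalence (stmt-1702). Here is what the same chain proves with NO hypothesis:

  `twec_legendreCeiling_unconditional` — for every `δ ∈ [1/10, 2/5]` there are `U₀ = 1` and
  `C = C₀(δ)(log 4 + 6) > 0` such that for `0 < U ≤ U₀`, eventually in `L`, EVERY normalised
  `(N_L, S^z=0)`-sector ground state `ψ` of `hubbardTorus 2 L 1 U` (`N_L = 2⌊(1−δ)L²/2⌋`) has
  `re⟨ψ, P_L ψ⟩/L⁴ ≤ C·U·(1 + log(1/U))`, `P_L = (pairField dWaveFormFactor L)ᴴ(pairField dWaveFormFactor L)`.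

It is the ceiling functor `twec_ceilingEngineAt` at `β = 1/U`, fed with
(T) the Slater thermal bound `thermalBound_slater` at the Weyl-law chemical potential
`μ(δ) ∈ [−3, −4 sin²(π/50)]` of `exists_window_tendsto_torusLevelCount` (slack `2U`; the counting
error is absorbed by `countingError_small`), and (G) the proved free `d`-wave inertness
`dWaveSource_free_sourcedGain_le` plus the interaction comparison `sourcedGain_le_free_add`
(slope `C₀(1 + log β)`, slack `2U`). This is the `d`-wave, `δ ∈ [1/10,2/5]` case of the Legendre
ceiling of card probe-legendre-order-ceiling (cf. `WeakCouplingBCS.WcbcsLegendreCeiling`, which is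
stated for all form factors and dopings with `U ∈ (0,U₀)`, `L + 1` indexing and `C·U·log(1/U)`), by a
different (thermal) route. The exponential improvement is exactly the content of stmt-1696.
-/

noncomputable section

namespace Summit.HubbardSuperconductivity.HubbardSuperconductivity.Theorems

open Literature.MathematicalPhysics.QuantumLattice Matrix Finset Filter Topology
open Literature.Probability.LatticeModels
open Summit.HubbardSuperconductivity.TwTipContinuation.Negative
open scoped ComplexOrder

/-- **The UNCONDITIONAL Legendre ceiling.** For every doping `δ ∈ [1/10, 2/5]` there are
`U₀, C > 0` such that for `0 < U ≤ U₀`, eventually in `L`, EVERY normalised `(N_L, S^z=0)`-sector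
ground state `ψ` of the weakly repulsive Hubbard torus `hubbardTorus 2 L 1 U`
(`N_L = 2⌊(1−δ)L²/2⌋`) has `d`-wave pair order
`re⟨ψ, P_L ψ⟩/L⁴ ≤ C · U · (1 + log (1/U))`, `P_L = Δ_d†Δ_d·2`. The ceiling functor
(`twec_ceilingEngineAt`) at `β = 1/U` fed with: (T) the Slater thermal bound at the Weyl-law
chemical potential `μ(δ) ∈ [−3, −4sin²(π/50)]` (slack `2U`), and (G) the proved free `d`-wave
inertness plus the interaction comparison (slope `C₀(1 + log β)`, slack `2U`). No hypothesis.
[folklore] -/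
theorem twec_legendreCeiling_unconditional :
    ∀ δ ∈ Set.Icc (1/10 : ℝ) (2/5 : ℝ), ∃ U₀ C : ℝ, 0 < U₀ ∧ 0 < C ∧ ∀ U ∈ Set.Ioc (0 : ℝ) U₀,
      ∃ L₀ : ℕ, ∀ (L : ℕ) [NeZero L], L₀ ≤ L → ∀ ψ : Fock (Orb (FermionTorus 2 L)),
        star ψ ⬝ᵥ ψ = 1 →
          IsGroundStateInSector (hubbardTorus 2 L 1 U) (2 * ⌊(1 - δ) * (L : ℝ) ^ 2 / 2⌋₊) 0 ψ →
            (expect ((pairField dWaveFormFactor L)ᴴ * pairField dWaveFormFactor L) ψ).re /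
                (L : ℝ) ^ 4 ≤ C * U * (1 + Real.log (1 / U)) := by
  intro δ hδ
  obtain ⟨μ₁, μ₂, hμ₁, hμ₁₂, hμ₂, hwin⟩ := exists_window_tendsto_torusLevelCount
  have ht : (1 - δ) / 2 ∈ Set.Icc (3 / 10 : ℝ) (9 / 20) := by
    obtain ⟨h1, h2⟩ := hδ; constructor <;> linarith
  obtain ⟨μ, hμ, hcount⟩ := hwin _ ht
  obtain ⟨C₀, hC₀, hFree⟩ := dWaveSource_free_sourcedGain_le μ₁ μ₂ hμ₁ hμ₁₂ hμ₂
  have hlog4 : 0 < Real.log 4 := Real.log_pos (by norm_num)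
  refine ⟨1, C₀ * (Real.log 4 + 6), one_pos, by positivity, ?_⟩
  intro U hU
  obtain ⟨hU0, hU1⟩ := hU
  have hμabs : |μ| ≤ 4 := by
    rw [abs_le]; obtain ⟨h1, h2⟩ := hμ; constructor <;> linarith
  set β : ℝ := 1 / U with hβdef
  have hβ1 : 1 ≤ β := by rw [hβdef, le_div_iff₀ hU0]; linarith
  have hβpos : 0 < β := lt_of_lt_of_le one_pos hβ1
  have hlogβ : 0 < 1 + Real.log β := by
    have := Real.log_nonneg hβ1; linarith
  have hK : 0 < C₀ * (1 + Real.log β) := mul_pos hC₀ hlogβ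
  -- (T): the Slater thermal bound with slack `2U`
  have hT : ∀ ε : ℝ, 0 < ε → ∃ L₀ : ℕ, ∀ (L : ℕ) [NeZero L], L₀ ≤ L →
      ((hubbardTorus 2 L 1 U).minEnergyOn
            (szSector (Λ := FermionTorus 2 L) (2 * ⌊(1 - δ) * (L : ℝ) ^ 2 / 2⌋₊) 0) / (L : ℝ) ^ 2) +
          (Real.log (partitionFn β (hubbardTorusWith 2 L 1 U μ)).re / (β * (L : ℝ) ^ 2)) -
          μ * ((2 * ⌊(1 - δ) * (L : ℝ) ^ 2 / 2⌋₊) : ℝ) / (L : ℝ) ^ 2 ≤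
        Real.log 4 / β + ε + 2 * U := by
    intro ε hε
    obtain ⟨L₀, hL₀⟩ := countingError_small (μ := μ) (by linarith [hδ.2]) hcount ε hε
    refine ⟨max L₀ 3, fun L _ hL => ?_⟩
    have hL3 : 3 ≤ L := (le_max_right _ _).trans hL
    have hLL₀ : L₀ ≤ L := (le_max_left _ _).trans hL
    have hn : ⌊(1 - δ) * (L : ℝ) ^ 2 / 2⌋₊ ≤ L ^ 2 := by
      have h1 : (1 - δ) * (L : ℝ) ^ 2 / 2 ≤ ((L ^ 2 : ℕ) : ℝ) := by
        have : 0 ≤ (L : ℝ) ^ 2 := by positivity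
        push_cast
        nlinarith [hδ.1, hδ.2]
      calc ⌊(1 - δ) * (L : ℝ) ^ 2 / 2⌋₊ ≤ ⌊((L ^ 2 : ℕ) : ℝ)⌋₊ := Nat.floor_le_floor h1
        _ = L ^ 2 := Nat.floor_natCast _
    have hmain := thermalBound_slater hL3 U hμabs hβpos hn
    have herr := hL₀ L hLL₀
    rw [abs_of_pos hU0] at hmain
    have hcast : μ * ((2 * ⌊(1 - δ) * (L : ℝ) ^ 2 / 2⌋₊ : ℕ) : ℝ) / (L : ℝ) ^ 2 =
        μ * ((2 * ⌊(1 - δ) * (L : ℝ) ^ 2 / 2⌋₊) : ℝ) / (L : ℝ) ^ 2 := by push_cast; ring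
    rw [hcast] at hmain
    linarith
  -- (G): free inertness + interaction comparison
  have hG : ∃ L₀ : ℕ, ∀ (L : ℕ) [NeZero L], L₀ ≤ L → ∀ h : ℝ,
      Real.log (partitionFn β (dWaveSourceTorus L U μ h)).re / (β * (L : ℝ) ^ 2) -
          Real.log (partitionFn β (dWaveSourceTorus L U μ 0)).re / (β * (L : ℝ) ^ 2) ≤
        C₀ * (1 + Real.log β) * h ^ 2 + 2 * U := by
    obtain ⟨L₀, hL₀⟩ := hFree β hβ1 μ hμ
    refine ⟨L₀, fun L _ hL h => ?_⟩
    have hfree := hL₀ L hL h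
    have hcomp := sourcedGain_le_free_add L U μ h hβpos
    rw [abs_of_pos hU0] at hcomp
    linarith
  obtain ⟨L₀, hL₀⟩ := twec_ceilingEngineAt (δ := δ) (D := 2 * U) (D' := 2 * U) hβpos hK hT hG U hU0
  refine ⟨L₀, fun L _ hL ψ hψ hgs => ?_⟩
  have key := hL₀ L hL ψ hψ hgs
  have e : C₀ * (1 + Real.log β) * (Real.log 4 / β + 2 * U + 2 * U + 2 * U) =
      C₀ * (Real.log 4 + 6) * U * (1 + Real.log (1 / U)) := by
    rw [hβdef]
    field_simp
    ring
  linarith [key, e.le, e.ge]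


end Summit.HubbardSuperconductivity.HubbardSuperconductivity.Theorems
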